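import Literature.NumberTheory.EllipticCurves.SingularModuliHilbertClassField
import Literature.NumberTheory.EllipticCurves.HeegnerPointsSingularModuliField
import HarnessLib

/-!
# The embedding of the Hilbert class field into `ℂ` covers the field of singular moduli

Topic `NumberTheory/EllipticCurves` (complex multiplication meets class field theory), namespace
`Literature.NumberTheory.EllipticCurves`.  Theorem-only file (no definition, no named fact).

`SingularModuliHilbertClassField.lean` produces, for `K` imaginary quadratic and a finite Galois
`H ⊂ K̄` in which only principal degree-one primes split completely (the Hilbert class field), an
embedding `σ : H → ℂ` and `j₀ ∈ 𝓞_H` with `σ(j₀) = j(τ_{d_K})`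
(`exists_ringHom_apply_eq_formJ_of_splitPrimes_principal`).  The same construction gives more, which
the downstream plumbing of `Literature.Barriers.ABC.OWeakUniformABCImpliesNoSiegelZeros` needs in order
to move ideal-theoretic statements proved inside `ℂ` (in the concrete field of singular moduli
`H_K = singularModuliField K ι ⊂ ℂ`) to the abstract field `H`:

* `exists_ringHom_apply_eq_formJ_range` — `σ` and `j₀` as above **with every singular modulus of
  discriminant `d_K` in the range of `σ`** (all roots of `H_{d_K}` in `K̄` lie in `H`,
  `rootSet_minpoly_formJ_subset_of_splitPrimes_principal`, and the chosen `K̄ → ℂ` maps them onto the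
  complex roots, which are the `j(τ_Q)`, `Q` reduced);
* `singularModuliField_le_fieldRange` — hence `H_K ⊆ σ(H)` for `ι = σ ∘ (K → H)`;
* `exists_ringHom_singularModuliField_comp_eq` — so there is a ring embedding
  `e : H_K → H` with `σ ∘ e = incl`;
* `exists_span_map_eq_pow` — transport of principal ideals and of cube/square factorizations of ideals
  along `e` on rings of integers (`Ideal.map_span`, `Ideal.map_pow`).

## References

* D. A. Cox, *Primes of the form x² + ny²*, 2nd ed., 2013, §11.A Thm. 11.1, Cor. 11.37. [Cox2013]
* A. Granville, H. M. Stark, Invent. Math. 139 (2000), §2 Lemma 1. [GranvilleStark2000]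
-/

noncomputable section

open NumberField IsDedekindDomain Polynomial Filter

namespace Literature.NumberTheory.EllipticCurves

open Literature.NumberTheory.GaloisRepresentations
open Literature.NumberTheory.QuadraticFields.BinaryQuadraticForm
open Literature.NumberTheory.QuadraticFields.Quadratic

universe u

variable (K : Type) [Field K] [NumberField K]

/-- **The embedding `σ : H → ℂ` with `σ(j₀) = j(τ_{d_K})` has every singular modulus of discriminant
`d_K` in its range.** [cite: Cox2013, §11.A Thm. 11.1 and Cor. 11.37] -/
theorem exists_ringHom_apply_eq_formJ_range (hK : IsImaginaryQuadratic K)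
    (H : IntermediateField K (AlgebraicClosure K)) [FiniteDimensional K H] [IsGalois K H]
    (hspl : ∀ᶠ v : HeightOneSpectrum (𝓞 K) in cofinite, (Ideal.absNorm v.asIdeal).Prime →
      v ∈ splitPrimes K H → v.asIdeal.IsPrincipal) :
    ∃ (σ : H →+* ℂ) (j₀ : 𝓞 H), σ j₀ = formJ (principalForm (NumberField.discr K)) ∧
      ∀ Q ∈ reducedForms (NumberField.discr K), formJ Q ∈ Set.range σ := by
  classical
  set Ω := AlgebraicClosure K
  set D : ℤ := NumberField.discr K with hDdef
  have h2 : Module.finrank ℚ K = 2 := hK.1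
  have hD : D < 0 := hK.discr_neg
  have h4 : D % 4 = 0 ∨ D % 4 = 1 := discr_emod_four h2
  have hP : principalForm D ∈ reducedForms D := principalForm_mem_reducedForms hD h4
  set g : ℚ[X] := minpoly ℚ (formJ (principalForm D)) with hgdef
  have hsub := rootSet_minpoly_formJ_subset_of_splitPrimes_principal K hK H hspl
  -- `j(τ_D)` is an algebraic integer, a root of `g`; every `j(τ_Q)` is a root of `g = H_D`
  have hint : IsIntegral ℤ (formJ (principalForm D)) :=
    isIntegral_int_formJ (by rw [principalForm_fst]; exact one_pos) (isPrimitive_principalForm _)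
      (by rw [discr_principalForm h4]; exact hD)
  have hg0 : g ≠ 0 := minpoly.ne_zero hint.tower_top
  have hgC : g.map (algebraMap ℚ ℂ) = classPolynomial D := minpoly_formJ_map_eq_classPolynomial hD hP
  have hroots : ∀ Q ∈ reducedForms D, formJ Q ∈ g.rootSet ℂ := by
    intro Q hQ
    rw [mem_rootSet]
    refine ⟨hg0, ?_⟩
    rw [aeval_def, eval₂_eq_eval_map, hgC, classPolynomial, eval_prod]
    exact Finset.prod_eq_zero hQ (by simp)
  have hjP : formJ (principalForm D) ∈ g.rootSet ℂ := hroots _ hP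
  -- an embedding `K̄ → ℂ`; it maps the roots of `g` in `K̄` onto the complex roots
  haveI : Algebra.IsAlgebraic ℚ Ω := Algebra.IsAlgebraic.trans ℚ K Ω
  set ψ : Ω →ₐ[ℚ] ℂ := IsAlgClosed.lift with hψdef
  have himage : ψ '' g.rootSet Ω = g.rootSet ℂ :=
    (IsAlgClosed.splits (g.map (algebraMap ℚ Ω))).image_rootSet ψ
  have hrootΩ : ∀ t ∈ g.rootSet Ω, t ∈ H := by
    intro t ht
    apply hsub
    rw [mem_rootSet] at ht ⊢
    refine ⟨(Polynomial.map_ne_zero_iff (algebraMap ℚ K).injective).mpr hg0, ?_⟩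
    rw [aeval_map_algebraMap]
    exact ht.2
  rw [← himage] at hjP
  obtain ⟨t₀, ht₀, hψt₀⟩ := hjP
  have ht₀H : t₀ ∈ H := hrootΩ t₀ ht₀
  have hint₀ : IsIntegral ℤ t₀ := by
    rw [← hψt₀] at hint
    exact (isIntegral_algHom_iff ψ.toRingHom.toIntAlgHom ψ.injective).mp hint
  have hintH : IsIntegral ℤ (⟨t₀, ht₀H⟩ : H) :=
    (isIntegral_algebraMap_iff (FaithfulSMul.algebraMap_injective H Ω)).mp hint₀
  refine ⟨ψ.toRingHom.comp (algebraMap H Ω), ⟨⟨t₀, ht₀H⟩, hintH⟩, hψt₀, ?_⟩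
  intro Q hQ
  have hQC := hroots Q hQ
  rw [← himage] at hQC
  obtain ⟨t, ht, hψt⟩ := hQC
  exact ⟨⟨t, hrootΩ t ht⟩, hψt⟩

variable {K}

/-- **`H_K ⊆ σ(H)`**: the field of singular moduli for the embedding `ι = σ ∘ (K → H)` lies in the
range of `σ`, once every singular modulus of discriminant `d_K` does. [folklore] -/
theorem singularModuliField_le_fieldRange {H : Type u} [Field H] [Algebra K H] (σ : H →+* ℂ)
    (hroots : ∀ Q ∈ reducedForms (NumberField.discr K), formJ Q ∈ Set.range σ) :
    singularModuliField K (σ.comp (algebraMap K H)) ≤ σ.fieldRange := by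
  rw [singularModuliField, Subfield.closure_le]
  rintro z (⟨k, rfl⟩ | hz)
  · exact ⟨algebraMap K H k, rfl⟩
  · obtain ⟨Q, hQ, rfl⟩ := Finset.mem_image.mp (Finset.mem_coe.mp hz)
    obtain ⟨h, hh⟩ := hroots Q hQ
    exact ⟨h, hh⟩

/-- **A ring embedding `e : H_K → H` with `σ ∘ e = incl`**, when `H_K ⊆ σ(H)`. [folklore] -/
theorem exists_ringHom_singularModuliField_comp_eq {H : Type u} [Field H] (σ : H →+* ℂ)
    {S : Subfield ℂ} (hle : S ≤ σ.fieldRange) :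
    ∃ e : S →+* H, ∀ z : S, σ (e z) = z := by
  refine ⟨σ.rangeRestrictFieldEquiv.symm.toRingHom.comp (Subfield.inclusion hle), fun z ↦ ?_⟩
  rw [RingHom.coe_comp, Function.comp_apply, RingEquiv.toRingHom_eq_coe, RingEquiv.coe_toRingHom,
    RingHom.rangeRestrictFieldEquiv_apply_symm_apply]
  rfl

/-- **Transport of a power factorization of a principal ideal along a ring map**:
if `(a) = 𝔞ⁿ` then `(f a) = (f 𝔞)ⁿ`. [folklore] -/
theorem exists_span_map_eq_pow {A B : Type*} [CommRing A] [CommRing B] (f : A →+* B) {a : A} {n : ℕ}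
    (h : ∃ 𝔞 : Ideal A, Ideal.span {a} = 𝔞 ^ n) : ∃ 𝔟 : Ideal B, Ideal.span {f a} = 𝔟 ^ n := by
  obtain ⟨𝔞, h𝔞⟩ := h
  refine ⟨𝔞.map f, ?_⟩
  rw [← Ideal.map_pow, ← h𝔞, Ideal.map_span, Set.image_singleton]

end Literature.NumberTheory.EllipticCurves

end
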